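import Summits.QuantumFields.YangMills.Theorems.BalabanUVNodesPortZDStepRows
import Summits.QuantumFields.YangMills.Theorems.BalabanUVNodesK0RecordFormatNamesLemmas4
import Literature.MathematicalPhysics.QuantumFieldTheory.Balaban1983to89.Node00.EuclCovAxOfRecord

/-!
# NODE O port, row PT-A-2 S5-0 (ii) — FILE E4b: [Balaban1987RG1] (2.17) p. 269 ∕ p. 263 «the explicitly defined expressions … are invariant with respect to
# the Euclidean transformations» FOR THE STEP FUNCTIONAL `R_k(A)` AND THE MERGED TERM `𝓝_{k+1}`, IN THE PRINTED ON-DOMAIN FORM — the Euclidean twin of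
# PTZ-1's `BalabanUVNodesPortZDStepRowsOn` (`apply_iter_Uk_gaugeAct_on ∕ stepOutT_gaugeAct_on ∕ mergedTermT_gaugeAct_on`): for each generator
# `r ∈ {τ_a, π, c_ρ}` of (2.17), `R_k(A)(rW) = R_k(A)(W)` for `W` in the step's domain, given the image of the level-k density invariant ON the
# level-(k+1) domain (the shape FILE E4a `TcanOfRecord_<r>_of_mem_regSet_inter_of_on` delivers at `T := TcanOfRecord`), `A` gauge- AND `r`-invariant ON
# the level-k domain, the nesting binder and the [B11] clauses

CITATION HEADER.  [I] = [Balaban1987RG1] (2.17) p. 269, p. 263, (0.19) p. 255, (0.21) p. 256, (1.6) p. 261; [15] = [Balaban1985Variational] Thm 1 p. 279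
(solvability ∕ uniqueness of the minimal orbit — HYPOTHESES `UkExists`, `UniqueUkOrbit`).  Porter PT-A-2 (`ymgap-nodeO-port-PTA-2`), `--supports
stmt-QuantumFields-27930 --as helper`.  Reused BY NAME: `B12EuclClause263.IsBackground.translate ∕ .creflect ∕ .permute` with FILE E2's certificates
`Node00.avOfRecord_nestedCovariant ∕ bgReg_*`, `B16Sect1Backgrounds.iter_gaugeAct`, `T4Continuum.iter_translate ∕ iter_permute ∕ iter_creflect`.

WHAT IS PROVED.  §1 `orbitRel_Uk_translate ∕ _permute ∕ _creflect` (`U_{k}(rV)` lies in the residual orbit of `r U_k(V)` on the [B11] domain);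
§2 `apply_iter_Uk_<r>_on` (a functional gauge- and `r`-invariant on a stable level-k set reads the same value at `Ū^k U_{k+1}(rW)` and at `Ū^k U_{k+1}(W)`);
§3 `nextAction_eq_of_image_eq`, `stepOutT_<r>_on`, `mergedTermT_<r>_on` (`𝓝_{k+1}(rW) = 𝓝_{k+1}(W)` on the domain, displayed image ∕ invariance ∕ nesting rows).
§4 the chart-level faces at the 27930⁸ token: `readField_translate ∕ _permute` (`rfl`), `recordΦfAx_translate_of ∕ _permute_of` — `Φf(B ∘ τ_a) = Φf(B)`, `Φf(πB) = Φf(B)`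
AS SOON AS the merged term takes equal values at the two charted configurations (the §3 row at `W_B`).
HONEST FRAMING.  Bookkeeping; the displayed rows are hypotheses; nothing of Bałaban's estimates asserted, ported or discharged; 27930⁸ signed-open; no `sorry`,
standard axioms; finite 𝕋⁴ at fixed ε — NOT continuum∕OS∕Clay; the Yang–Mills mass gap is NOT proved by any of this.
-/

noncomputable section

namespace Summit.QuantumFields.YangMills.Theorems.BalabanUVNodesPortS1

open Literature.MathematicalPhysics.QuantumFieldTheory.Balaban1983to89
open Literature.MathematicalPhysics.QuantumFieldTheory.Balaban1983to89.Node00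
open Literature.MathematicalPhysics.QuantumFieldTheory.Balaban1983to89.Node00.ZeroInput
open T4Continuum (T4Family)
open B12Eq019ActionBody (nextAction nextAction_apply integrand)
open B12GaugeOrbits021 (OrbitRel)
open B16Sect1Backgrounds (toMS iter_gaugeAct)
open B12EuclClause263 (IsBackground.translate IsBackground.creflect IsBackground.permute)
open GaugeField (gaugeAct)

variable {F : T4Family} {N : ℕ} [NeZero N]

/-! ## §1. The minimiser of the transformed field lies in the residual orbit of the transformed minimiser -/

/-- **`U_k(τ_a V) ∼ τ_{L^k a} U_k(V)`** (residual orbit) for `V` solvable with ONE minimal orbit at `τ_a V`. [cite: Balaban1987RG1, (0.21) p.256, (2.17) p.269; Balaban1985Variational, Thm 1 p.279] -/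
theorem orbitRel_Uk_translate {K k : ℕ} {ε : ℝ} (a : Site (F.P K) k) {V : GaugeField (F.P K) k (SU N)} (h : UkExists F N K k ε V)
    (hu : UniqueUkOrbit F N K k ε (V.translate a)) :
    OrbitRel k ((Uk F N K k ε V).translate (Site.scaleTo k a)) (Uk F N K k ε (V.translate a)) := by
  have hB := IsBackground.translate (avOfRecord_nestedCovariant F N K) (fun a' U hU => bgReg_translate F N K _ _ (Site.scaleTo k a') U hU)
    (isBackground_Uk h) a
  exact hu _ _ hB (isBackground_Uk ⟨_, hB⟩)

/-- **`U_k(π V) ∼ π U_k(V)`** (residual orbit) for `V` solvable with ONE minimal orbit at `π V`. [cite: Balaban1987RG1, (0.21) p.256, (2.17) p.269; Balaban1985Variational, Thm 1 p.279] -/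
theorem orbitRel_Uk_permute {K k : ℕ} {ε : ℝ} (π : Equiv.Perm (Fin (F.P K).d)) {V : GaugeField (F.P K) k (SU N)} (h : UkExists F N K k ε V)
    (hu : UniqueUkOrbit F N K k ε (V.permute π)) :
    OrbitRel k ((Uk F N K k ε V).permute π) (Uk F N K k ε (V.permute π)) := by
  have hB := IsBackground.permute (avOfRecord_nestedCovariant F N K) (fun π U hU => bgReg_permute F N K _ _ π U hU) (isBackground_Uk h) π
  exact hu _ _ hB (isBackground_Uk ⟨_, hB⟩)

/-- **`U_k(c_ρ V) ∼ c_ρ U_k(V)`** (residual orbit) for `V` solvable with ONE minimal orbit at `c_ρ V`. [cite: Balaban1987RG1, (0.21) p.256, (2.17) p.269; Balaban1985Variational, Thm 1 p.279] -/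
theorem orbitRel_Uk_creflect {K k : ℕ} {ε : ℝ} (r : Fin (F.P K).d) {V : GaugeField (F.P K) k (SU N)} (h : UkExists F N K k ε V)
    (hu : UniqueUkOrbit F N K k ε (V.creflect r)) :
    OrbitRel k ((Uk F N K k ε V).creflect r) (Uk F N K k ε (V.creflect r)) := by
  have hB := IsBackground.creflect (avOfRecord_nestedCovariant F N K) (fun r U hU => bgReg_creflect F N K _ _ r U hU) (isBackground_Uk h) r
  exact hu _ _ hB (isBackground_Uk ⟨_, hB⟩)

/-! ## §2. A gauge- and `r`-invariant functional on a stable level-k set reads the same value at `Ū^k U_{k+1}(rW)` and `Ū^k U_{k+1}(W)` -/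

/-- **Translations.** [cite: Balaban1987RG1, (0.21) p.256, (2.17) p.269, p.263] -/
theorem apply_iter_Uk_translate_on {K k : ℕ} (hk : k + 1 ≤ (F.P K).m + (F.P K).K) {ε : ℝ} {A : Density (F.P K) k (SU N)}
    {D : Set (GaugeField (F.P K) k (SU N))} (a : Site (F.P K) (k + 1))
    (hAon : ∀ (w : GaugeTransf (F.P K) k (SU N)) (U : GaugeField (F.P K) k (SU N)), U ∈ D → A (gaugeAct w U) = A U)
    (hDtr : ∀ U : GaugeField (F.P K) k (SU N), U ∈ D → U.translate (Site.scale a) ∈ D)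
    (hAtr : ∀ U : GaugeField (F.P K) k (SU N), U ∈ D → A (U.translate (Site.scale a)) = A U)
    {W : GaugeField (F.P K) (k + 1) (SU N)} (hnest : Averaging.iter (avOfRecord F N K) k (Uk F N K (k + 1) ε W) ∈ D)
    (hW : UkExists F N K (k + 1) ε W) (hu : UniqueUkOrbit F N K (k + 1) ε (W.translate a)) :
    A (Averaging.iter (avOfRecord F N K) k (Uk F N K (k + 1) ε (W.translate a))) = A (Averaging.iter (avOfRecord F N K) k (Uk F N K (k + 1) ε W)) := by
  obtain ⟨u, -, hEq⟩ := orbitRel_Uk_translate a hW hu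
  have hk' : k ≤ (F.P K).m + (F.P K).K := Nat.le_of_succ_le hk
  rw [hEq, iter_gaugeAct (avOfRecord F N K) u _ k hk', show Site.scaleTo (k + 1) a = Site.scaleTo k (Site.scale a) from rfl,
    T4Continuum.iter_translate _ (avOfRecord_nestedCovariant F N K).1 k (Site.scale a), hAon _ _ (hDtr _ hnest), hAtr _ hnest]

/-- **Coordinate permutations.** [cite: Balaban1987RG1, (0.21) p.256, (2.17) p.269, p.263] -/
theorem apply_iter_Uk_permute_on {K k : ℕ} (hk : k + 1 ≤ (F.P K).m + (F.P K).K) {ε : ℝ} {A : Density (F.P K) k (SU N)}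
    {D : Set (GaugeField (F.P K) k (SU N))} (π : Equiv.Perm (Fin (F.P K).d))
    (hAon : ∀ (w : GaugeTransf (F.P K) k (SU N)) (U : GaugeField (F.P K) k (SU N)), U ∈ D → A (gaugeAct w U) = A U)
    (hDπ : ∀ U : GaugeField (F.P K) k (SU N), U ∈ D → U.permute π ∈ D)
    (hAπ : ∀ U : GaugeField (F.P K) k (SU N), U ∈ D → A (U.permute π) = A U)
    {W : GaugeField (F.P K) (k + 1) (SU N)} (hnest : Averaging.iter (avOfRecord F N K) k (Uk F N K (k + 1) ε W) ∈ D)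
    (hW : UkExists F N K (k + 1) ε W) (hu : UniqueUkOrbit F N K (k + 1) ε (W.permute π)) :
    A (Averaging.iter (avOfRecord F N K) k (Uk F N K (k + 1) ε (W.permute π))) = A (Averaging.iter (avOfRecord F N K) k (Uk F N K (k + 1) ε W)) := by
  obtain ⟨u, -, hEq⟩ := orbitRel_Uk_permute π hW hu
  have hk' : k ≤ (F.P K).m + (F.P K).K := Nat.le_of_succ_le hk
  rw [hEq, iter_gaugeAct (avOfRecord F N K) u _ k hk', T4Continuum.iter_permute _ π ((avOfRecord_nestedCovariant F N K).2.2 · π) k,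
    hAon _ _ (hDπ _ hnest), hAπ _ hnest]

/-- **Centre reflections.** [cite: Balaban1987RG1, (0.21) p.256, (2.17) p.269, p.263] -/
theorem apply_iter_Uk_creflect_on {K k : ℕ} (hk : k + 1 ≤ (F.P K).m + (F.P K).K) {ε : ℝ} {A : Density (F.P K) k (SU N)}
    {D : Set (GaugeField (F.P K) k (SU N))} (r : Fin (F.P K).d)
    (hAon : ∀ (w : GaugeTransf (F.P K) k (SU N)) (U : GaugeField (F.P K) k (SU N)), U ∈ D → A (gaugeAct w U) = A U)
    (hDr : ∀ U : GaugeField (F.P K) k (SU N), U ∈ D → U.creflect r ∈ D)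
    (hAr : ∀ U : GaugeField (F.P K) k (SU N), U ∈ D → A (U.creflect r) = A U)
    {W : GaugeField (F.P K) (k + 1) (SU N)} (hnest : Averaging.iter (avOfRecord F N K) k (Uk F N K (k + 1) ε W) ∈ D)
    (hW : UkExists F N K (k + 1) ε W) (hu : UniqueUkOrbit F N K (k + 1) ε (W.creflect r)) :
    A (Averaging.iter (avOfRecord F N K) k (Uk F N K (k + 1) ε (W.creflect r))) = A (Averaging.iter (avOfRecord F N K) k (Uk F N K (k + 1) ε W)) := by
  obtain ⟨u, -, hEq⟩ := orbitRel_Uk_creflect r hW hu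
  have hk' : k ≤ (F.P K).m + (F.P K).K := Nat.le_of_succ_le hk
  rw [hEq, iter_gaugeAct (avOfRecord F N K) u _ k hk', T4Continuum.iter_creflect _ r ((avOfRecord_nestedCovariant F N K).2.1 · r) k,
    hAon _ _ (hDr _ hnest), hAr _ hnest]

/-! ## §3. The step functional and the merged term on the domains -/

/-- `A_{k+1}` reads the transport's image only: equal images at two points give equal values. [cite: Balaban1987RG1, (0.19) p.255 (bookkeeping)] -/
theorem nextAction_eq_of_image_eq {P : Params} {G : Type*} [GaugeGroup G] {k : ℕ} {T : Density P k G → Density P (k + 1) G}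
    {χ GF A : Density P k G} {gk : ℝ} {V V' : GaugeField P (k + 1) G} (h : T (integrand χ GF gk A) V' = T (integrand χ GF gk A) V) :
    nextAction T χ GF gk A V' = nextAction T χ GF gk A V := by
  rw [nextAction_apply, nextAction_apply, h]

variable (F N)

/-- **`R_k(A)(τ_a W) = R_k(A)(W)` ON THE DOMAINS.** [cite: Balaban1987RG1, (2.17) p.269, p.263, (0.19) p.255] -/
theorem stepOutT_translate_on (T : Transport F N) (χ : (K : ℕ) → (ℕ → ℝ) → (k : ℕ) → Density (F.P K) k (SU N)) (ε : ℝ) {K : ℕ} (g : ℕ → ℝ)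
    {k : ℕ} (hk : k + 1 ≤ (F.P K).m + (F.P K).K) {A : Density (F.P K) k (SU N)} {D : Set (GaugeField (F.P K) k (SU N))}
    {D' : Set (GaugeField (F.P K) (k + 1) (SU N))} (a : Site (F.P K) (k + 1))
    (hTon : ∀ V : GaugeField (F.P K) (k + 1) (SU N), V ∈ D' →
      T K k (integrand (χ K g k) (gfOfRecord F N K k) (g k) A) (V.translate a) = T K k (integrand (χ K g k) (gfOfRecord F N K k) (g k) A) V)
    (hAon : ∀ (w : GaugeTransf (F.P K) k (SU N)) (U : GaugeField (F.P K) k (SU N)), U ∈ D → A (gaugeAct w U) = A U)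
    (hDtr : ∀ U : GaugeField (F.P K) k (SU N), U ∈ D → U.translate (Site.scale a) ∈ D)
    (hAtr : ∀ U : GaugeField (F.P K) k (SU N), U ∈ D → A (U.translate (Site.scale a)) = A U)
    {W : GaugeField (F.P K) (k + 1) (SU N)} (hWD : W ∈ D') (hnest : Averaging.iter (avOfRecord F N K) k (Uk F N K (k + 1) ε W) ∈ D)
    (hW : UkExists F N K (k + 1) ε W) (hu : UniqueUkOrbit F N K (k + 1) ε (W.translate a)) :
    stepOutT F N T χ ε K g k A (W.translate a) = stepOutT F N T χ ε K g k A W := by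
  rw [stepOutT, stepOutT, nextAction_eq_of_image_eq (hTon W hWD), apply_iter_Uk_translate_on hk a hAon hDtr hAtr hnest hW hu]

/-- **`R_k(A)(π W) = R_k(A)(W)` ON THE DOMAINS.** [cite: Balaban1987RG1, (2.17) p.269, p.263, (0.19) p.255] -/
theorem stepOutT_permute_on (T : Transport F N) (χ : (K : ℕ) → (ℕ → ℝ) → (k : ℕ) → Density (F.P K) k (SU N)) (ε : ℝ) {K : ℕ} (g : ℕ → ℝ)
    {k : ℕ} (hk : k + 1 ≤ (F.P K).m + (F.P K).K) {A : Density (F.P K) k (SU N)} {D : Set (GaugeField (F.P K) k (SU N))}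
    {D' : Set (GaugeField (F.P K) (k + 1) (SU N))} (π : Equiv.Perm (Fin (F.P K).d))
    (hTon : ∀ V : GaugeField (F.P K) (k + 1) (SU N), V ∈ D' →
      T K k (integrand (χ K g k) (gfOfRecord F N K k) (g k) A) (V.permute π) = T K k (integrand (χ K g k) (gfOfRecord F N K k) (g k) A) V)
    (hAon : ∀ (w : GaugeTransf (F.P K) k (SU N)) (U : GaugeField (F.P K) k (SU N)), U ∈ D → A (gaugeAct w U) = A U)
    (hDπ : ∀ U : GaugeField (F.P K) k (SU N), U ∈ D → U.permute π ∈ D)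
    (hAπ : ∀ U : GaugeField (F.P K) k (SU N), U ∈ D → A (U.permute π) = A U)
    {W : GaugeField (F.P K) (k + 1) (SU N)} (hWD : W ∈ D') (hnest : Averaging.iter (avOfRecord F N K) k (Uk F N K (k + 1) ε W) ∈ D)
    (hW : UkExists F N K (k + 1) ε W) (hu : UniqueUkOrbit F N K (k + 1) ε (W.permute π)) :
    stepOutT F N T χ ε K g k A (W.permute π) = stepOutT F N T χ ε K g k A W := by
  rw [stepOutT, stepOutT, nextAction_eq_of_image_eq (hTon W hWD), apply_iter_Uk_permute_on hk π hAon hDπ hAπ hnest hW hu]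

/-- **`R_k(A)(c_ρ W) = R_k(A)(W)` ON THE DOMAINS.** [cite: Balaban1987RG1, (2.17)–(2.18) p.269, p.263, (0.19) p.255] -/
theorem stepOutT_creflect_on (T : Transport F N) (χ : (K : ℕ) → (ℕ → ℝ) → (k : ℕ) → Density (F.P K) k (SU N)) (ε : ℝ) {K : ℕ} (g : ℕ → ℝ)
    {k : ℕ} (hk : k + 1 ≤ (F.P K).m + (F.P K).K) {A : Density (F.P K) k (SU N)} {D : Set (GaugeField (F.P K) k (SU N))}
    {D' : Set (GaugeField (F.P K) (k + 1) (SU N))} (r : Fin (F.P K).d)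
    (hTon : ∀ V : GaugeField (F.P K) (k + 1) (SU N), V ∈ D' →
      T K k (integrand (χ K g k) (gfOfRecord F N K k) (g k) A) (V.creflect r) = T K k (integrand (χ K g k) (gfOfRecord F N K k) (g k) A) V)
    (hAon : ∀ (w : GaugeTransf (F.P K) k (SU N)) (U : GaugeField (F.P K) k (SU N)), U ∈ D → A (gaugeAct w U) = A U)
    (hDr : ∀ U : GaugeField (F.P K) k (SU N), U ∈ D → U.creflect r ∈ D)
    (hAr : ∀ U : GaugeField (F.P K) k (SU N), U ∈ D → A (U.creflect r) = A U)
    {W : GaugeField (F.P K) (k + 1) (SU N)} (hWD : W ∈ D') (hnest : Averaging.iter (avOfRecord F N K) k (Uk F N K (k + 1) ε W) ∈ D)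
    (hW : UkExists F N K (k + 1) ε W) (hu : UniqueUkOrbit F N K (k + 1) ε (W.creflect r)) :
    stepOutT F N T χ ε K g k A (W.creflect r) = stepOutT F N T χ ε K g k A W := by
  rw [stepOutT, stepOutT, nextAction_eq_of_image_eq (hTon W hWD), apply_iter_Uk_creflect_on hk r hAon hDr hAr hnest hW hu]

/-- **THE MERGED TERM IS TRANSLATION INVARIANT ON THE DOMAIN**: `𝓝_{k+1}(τ_a W) = 𝓝_{k+1}(W)` for `W ∈ D'` (`A := A_k`; displayed: the image row for the level-k
density, `A_k` gauge- and `τ`-invariant ON `D`, the nesting binder, the [B11] clauses). [cite: Balaban1987RG1, (1.6) p.261, (2.17) p.269, p.263] -/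
theorem mergedTermT_translate_on (T : Transport F N) (χ : (K : ℕ) → (ℕ → ℝ) → (k : ℕ) → Density (F.P K) k (SU N)) (ε : ℝ) {K : ℕ}
    (g : ℕ → ℝ) {k : ℕ} (hk : k + 1 ≤ (F.P K).m + (F.P K).K) {D : Set (GaugeField (F.P K) k (SU N))}
    {D' : Set (GaugeField (F.P K) (k + 1) (SU N))} (a : Site (F.P K) (k + 1))
    (hTon : ∀ V : GaugeField (F.P K) (k + 1) (SU N), V ∈ D' →
      T K k (integrand (χ K g k) (gfOfRecord F N K k) (g k) (effActionHT F N T χ K g k)) (V.translate a) =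
        T K k (integrand (χ K g k) (gfOfRecord F N K k) (g k) (effActionHT F N T χ K g k)) V)
    (hAon : ∀ (w : GaugeTransf (F.P K) k (SU N)) (U : GaugeField (F.P K) k (SU N)), U ∈ D →
      effActionHT F N T χ K g k (gaugeAct w U) = effActionHT F N T χ K g k U)
    (hDtr : ∀ U : GaugeField (F.P K) k (SU N), U ∈ D → U.translate (Site.scale a) ∈ D)
    (hAtr : ∀ U : GaugeField (F.P K) k (SU N), U ∈ D → effActionHT F N T χ K g k (U.translate (Site.scale a)) = effActionHT F N T χ K g k U)
    {W : GaugeField (F.P K) (k + 1) (SU N)} (hWD : W ∈ D') (hnest : Averaging.iter (avOfRecord F N K) k (Uk F N K (k + 1) ε W) ∈ D)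
    (hW : UkExists F N K (k + 1) ε W) (hu : UniqueUkOrbit F N K (k + 1) ε (W.translate a)) :
    mergedTermT F N T χ ε K g k (W.translate a) = mergedTermT F N T χ ε K g k W := by
  rw [mergedTermT_eq_stepOut, mergedTermT_eq_stepOut]
  exact stepOutT_translate_on F N T χ ε g hk a hTon hAon hDtr hAtr hWD hnest hW hu

/-- **THE MERGED TERM IS PERMUTATION INVARIANT ON THE DOMAIN.** [cite: Balaban1987RG1, (1.6) p.261, (2.17) p.269, p.263] -/
theorem mergedTermT_permute_on (T : Transport F N) (χ : (K : ℕ) → (ℕ → ℝ) → (k : ℕ) → Density (F.P K) k (SU N)) (ε : ℝ) {K : ℕ}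
    (g : ℕ → ℝ) {k : ℕ} (hk : k + 1 ≤ (F.P K).m + (F.P K).K) {D : Set (GaugeField (F.P K) k (SU N))}
    {D' : Set (GaugeField (F.P K) (k + 1) (SU N))} (π : Equiv.Perm (Fin (F.P K).d))
    (hTon : ∀ V : GaugeField (F.P K) (k + 1) (SU N), V ∈ D' →
      T K k (integrand (χ K g k) (gfOfRecord F N K k) (g k) (effActionHT F N T χ K g k)) (V.permute π) =
        T K k (integrand (χ K g k) (gfOfRecord F N K k) (g k) (effActionHT F N T χ K g k)) V)
    (hAon : ∀ (w : GaugeTransf (F.P K) k (SU N)) (U : GaugeField (F.P K) k (SU N)), U ∈ D →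
      effActionHT F N T χ K g k (gaugeAct w U) = effActionHT F N T χ K g k U)
    (hDπ : ∀ U : GaugeField (F.P K) k (SU N), U ∈ D → U.permute π ∈ D)
    (hAπ : ∀ U : GaugeField (F.P K) k (SU N), U ∈ D → effActionHT F N T χ K g k (U.permute π) = effActionHT F N T χ K g k U)
    {W : GaugeField (F.P K) (k + 1) (SU N)} (hWD : W ∈ D') (hnest : Averaging.iter (avOfRecord F N K) k (Uk F N K (k + 1) ε W) ∈ D)
    (hW : UkExists F N K (k + 1) ε W) (hu : UniqueUkOrbit F N K (k + 1) ε (W.permute π)) :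
    mergedTermT F N T χ ε K g k (W.permute π) = mergedTermT F N T χ ε K g k W := by
  rw [mergedTermT_eq_stepOut, mergedTermT_eq_stepOut]
  exact stepOutT_permute_on F N T χ ε g hk π hTon hAon hDπ hAπ hWD hnest hW hu

/-- **THE MERGED TERM IS INVARIANT UNDER THE CENTRE REFLECTIONS ON THE DOMAIN.** [cite: Balaban1987RG1, (1.6) p.261, (2.17)–(2.18) p.269, p.263] -/
theorem mergedTermT_creflect_on (T : Transport F N) (χ : (K : ℕ) → (ℕ → ℝ) → (k : ℕ) → Density (F.P K) k (SU N)) (ε : ℝ) {K : ℕ}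
    (g : ℕ → ℝ) {k : ℕ} (hk : k + 1 ≤ (F.P K).m + (F.P K).K) {D : Set (GaugeField (F.P K) k (SU N))}
    {D' : Set (GaugeField (F.P K) (k + 1) (SU N))} (r : Fin (F.P K).d)
    (hTon : ∀ V : GaugeField (F.P K) (k + 1) (SU N), V ∈ D' →
      T K k (integrand (χ K g k) (gfOfRecord F N K k) (g k) (effActionHT F N T χ K g k)) (V.creflect r) =
        T K k (integrand (χ K g k) (gfOfRecord F N K k) (g k) (effActionHT F N T χ K g k)) V)
    (hAon : ∀ (w : GaugeTransf (F.P K) k (SU N)) (U : GaugeField (F.P K) k (SU N)), U ∈ D →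
      effActionHT F N T χ K g k (gaugeAct w U) = effActionHT F N T χ K g k U)
    (hDr : ∀ U : GaugeField (F.P K) k (SU N), U ∈ D → U.creflect r ∈ D)
    (hAr : ∀ U : GaugeField (F.P K) k (SU N), U ∈ D → effActionHT F N T χ K g k (U.creflect r) = effActionHT F N T χ K g k U)
    {W : GaugeField (F.P K) (k + 1) (SU N)} (hWD : W ∈ D') (hnest : Averaging.iter (avOfRecord F N K) k (Uk F N K (k + 1) ε W) ∈ D)
    (hW : UkExists F N K (k + 1) ε W) (hu : UniqueUkOrbit F N K (k + 1) ε (W.creflect r)) :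
    mergedTermT F N T χ ε K g k (W.creflect r) = mergedTermT F N T χ ε K g k W := by
  rw [mergedTermT_eq_stepOut, mergedTermT_eq_stepOut]
  exact stepOutT_creflect_on F N T χ ε g hk r hTon hAon hDr hAr hWD hnest hW hu

/-! ## §4. The chart-level faces at the 27930⁸ token `recordΦfAx` -/

section Chart

open Summit.QuantumFields.YangMills.Theorems.K0RecordFormatNames
open NormedSpace (exp)

variable {F N}

omit [NeZero N] in
/-- Reading a unit-lattice field through `r` commutes with the coarse translations: `(readField r W) ∘ τ_a = readField r (W ∘ τ_a)` (`rfl`). [cite: Balaban1987RG1, (2.17) p.269, p.264 (bookkeeping)] -/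
theorem readField_translate {𝔄 : Type*} (r : 𝔄 → SU N) {K j : ℕ} (W : Fin (F.P K).d → Site (F.P K) j → 𝔄) (a : Site (F.P K) j) :
    (readField F N r W).translate a = readField F N r (fun μ x => W μ (x + a)) := rfl

omit [NeZero N] in
/-- Reading through `r` commutes with the coordinate permutations: `(readField r W) ∘ π = readField r ((μ, x) ↦ W (π μ) (π x))` (`rfl`). [cite: Balaban1987RG1, (2.17) p.269, p.264 (bookkeeping)] -/
theorem readField_permute {𝔄 : Type*} (r : 𝔄 → SU N) {K j : ℕ} (W : Fin (F.P K).d → Site (F.P K) j → 𝔄) (π : Equiv.Perm (Fin (F.P K).d)) :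
    (readField F N r W).permute π = readField F N r (fun μ x => W (π μ) (x.permute π)) := rfl

variable (F) (a₀ ε₂₉ : ℝ)

/-- **`Φf(B ∘ τ_a) = Φf(B)` AT THE RE-CENTRED RECORD** as soon as the merged term `𝓝_{k+1}` takes the same value at the translated charted configuration
`τ_a W_B` and at `W_B` (`W_B = readField suOfMat (exp ρ₈ B)`; the §3 row `mergedTermT_translate_on` at `W_B` supplies it on the domain). [cite: Balaban1987RG1, (1.20) p.264, (2.17) p.269, p.292 (5.4)] -/
theorem recordΦfAx_translate_of (k : ℕ) (v : Fin (k + 1) → ℝ) (K : ℕ) (B : recordW F a₀ ε₂₉ k K) (a : Site (F.P K) (k + 1))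
    (h : letI θ := thetaFill F a₀ ε₂₉
      letI := θ.instVβ₁; letI := θ.instVβ₂
      mergedTermT F 2 (TβOfRecord₁₃ F 2) (chiβOfRecord₁₃Ax F 2 θ) θ.εbg K (T4FlagMemory.extd v) k
          ((readField F 2 (suOfMat 2) fun μ x => exp (θ.ρ8 (B μ x))).translate a) =
        mergedTermT F 2 (TβOfRecord₁₃ F 2) (chiβOfRecord₁₃Ax F 2 θ) θ.εbg K (T4FlagMemory.extd v) k (readField F 2 (suOfMat 2) fun μ x => exp (θ.ρ8 (B μ x)))) :
    recordΦfAx F a₀ ε₂₉ k v K (fun μ x => B μ (x + a)) = recordΦfAx F a₀ ε₂₉ k v K B := by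
  rw [recordΦfAx_eq_expChart, recordΦfAx_eq_expChart]
  simp only [B12PolarizationTensor120.expChart_apply, mergedTermFamilyMatT, mergedTermFamilyT]
  have h' := h
  rw [readField_translate] at h'
  exact congrArg (fun t : ℝ => (t : ℂ)) h'

/-- **`Φf(πB) = Φf(B)` AT THE RE-CENTRED RECORD** (`(πB) μ x = B (π μ) (π x)`) as soon as `𝓝_{k+1}` takes the same value at `π W_B` and at `W_B` (§3 row
`mergedTermT_permute_on`). [cite: Balaban1987RG1, (1.20) p.264, (2.17) p.269, p.292 (5.5)–(5.8)] -/
theorem recordΦfAx_permute_of (k : ℕ) (v : Fin (k + 1) → ℝ) (K : ℕ) (B : recordW F a₀ ε₂₉ k K) (π : Equiv.Perm (Fin (F.P K).d))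
    (h : letI θ := thetaFill F a₀ ε₂₉
      letI := θ.instVβ₁; letI := θ.instVβ₂
      mergedTermT F 2 (TβOfRecord₁₃ F 2) (chiβOfRecord₁₃Ax F 2 θ) θ.εbg K (T4FlagMemory.extd v) k
          ((readField F 2 (suOfMat 2) fun μ x => exp (θ.ρ8 (B μ x))).permute π) =
        mergedTermT F 2 (TβOfRecord₁₃ F 2) (chiβOfRecord₁₃Ax F 2 θ) θ.εbg K (T4FlagMemory.extd v) k (readField F 2 (suOfMat 2) fun μ x => exp (θ.ρ8 (B μ x)))) :
    recordΦfAx F a₀ ε₂₉ k v K (fun μ x => B (π μ) (x.permute π)) = recordΦfAx F a₀ ε₂₉ k v K B := by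
  rw [recordΦfAx_eq_expChart, recordΦfAx_eq_expChart]
  simp only [B12PolarizationTensor120.expChart_apply, mergedTermFamilyMatT, mergedTermFamilyT]
  have h' := h
  rw [readField_permute] at h'
  exact congrArg (fun t : ℝ => (t : ℂ)) h'

end Chart

end Summit.QuantumFields.YangMills.Theorems.BalabanUVNodesPortS1

end
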